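import Summits.KontsevichZagierPeriods.KontsevichZagierPeriods.Theorems.SymplecticScissorsRealOnePeriodRelationsStubPuiseuxGerm

/-!
# `CurvePeriodsTransfer` (stmt-KontsevichZagierPeriods-11129), line `standard-etale-models`:
# the stub `stub_puiseuxGerm`, discharged by the sibling crux's germ theorem

The registered stub `stub_puiseuxGerm` of crux `CurvePeriodsTransfer` (normalised Puiseux germ of a one-sided
`ℚ`-semialgebraic germ at an algebraic point) is, verbatim, the theorem
`RealOnePeriodRelations.PuiseuxGerm.puiseuxGerm` landed for the line `nash-retraction-thin-strip` of the sibling crux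
`RealOnePeriodRelations` (formal Newton–Puiseux over `algebraicClosure ℚ ℂ`, analytic realisation of the branches,
branch selection along the real arc, algebraic Taylor coefficients by re-truncation, normal form by isolated
zeros).  [cite: BochnakCosteRoy1998, §8.1] [cite: Kollar2007, 1.94–1.95]
-/

noncomputable section

open scoped Topology
open Literature.NumberTheory.Transcendental

namespace Summit.KontsevichZagierPeriods.SymplecticScissors.CurvePeriodsTransfer

/-- **Stub `stub_puiseuxGerm` (crux `CurvePeriodsTransfer`, line `standard-etale-models`).** Normalised Puiseux
germ of a one-sided `ℚ`-semialgebraic germ at an algebraic point: `f (a + s^q) = s^m · h(s)` for small `s > 0`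
with `h` analytic at `0`, algebraic Taylor coefficients, and `h 0 ≠ 0` or `h ≡ 0`.
[cite: BochnakCosteRoy1998, §8.1] [cite: Kollar2007, 1.94–1.95] -/
theorem stub_puiseuxGerm : ∀ (f : ℝ → ℝ) (a δ : ℝ), IsAlgebraic ℚ a → 0 < δ →
    IsSemialgebraicFunOn ℚ {z : Fin 1 → ℝ | z 0 ∈ Set.Ioo a (a + δ)} (fun z => f (z 0)) →
    ∃ (q : ℕ) (m : ℤ) (h : ℝ → ℝ), 0 < q ∧ AnalyticAt ℝ h 0 ∧ (∀ n, IsAlgebraic ℚ (iteratedDeriv n h 0)) ∧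
      (h 0 ≠ 0 ∨ ∀ s, h s = 0) ∧ ∀ᶠ s in 𝓝[>] (0 : ℝ), f (a + s ^ q) = s ^ m * h s :=
  RealOnePeriodRelations.PuiseuxGerm.puiseuxGerm

end Summit.KontsevichZagierPeriods.SymplecticScissors.CurvePeriodsTransfer

end
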